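import Mathlib
import Summits.AtomisticToContinuum.Crystallization.Theses.PhononSlackCertificates
import Summits.AtomisticToContinuum.Crystallization.Theorems.PhononSlackCertificatesNearFarGlueRHcpShell
import Summits.AtomisticToContinuum.Crystallization.Theorems.PhononSlackCertificatesNearFarGlueRLatticeShell
import Summits.AtomisticToContinuum.Crystallization.Theorems.ChargedEnergyGap.Negative.BlocksBound
import Summits.AtomisticToContinuum.Crystallization.Theorems.NearFarGlueR.Negative.GlueToolkit
import Summits.AtomisticToContinuum.Crystallization.Theorems.OneCentreSteepnessLadderDominationEnergyLimitHcp
import Literature.MathematicalPhysics.StatisticalMechanics.PeriodicConfigurationSums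
import Literature.MathematicalPhysics.StatisticalMechanics.LennardJonesClusters
import Literature.MathematicalPhysics.StatisticalMechanics.CrystallizationSymmetries
import Literature.MathematicalPhysics.StatisticalMechanics.BarlowCoordination
import Literature.MathematicalPhysics.StatisticalMechanics.HcpHomogeneous
import Literature.Geometry.DiscreteGeometry.TwoShellPatterns

/-!
# Crux `PhononSlackCertificates.NearFarGlueR` (stmt-AtomisticToContinuum-14970), line `Sketch`:
the target (hence the residual) HOLDS on sub-configurations of the hexagonal close packing

Continuation lead c2; part 2 of 2 (part 1: `PhononSlackCertificatesNearFarGlueRHcpShell.lean`).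
The registered residual of the line is the tight contact gap (bad particles next to good crystal
pay linearly against `N·e*`, `e* = ⨅_Q e(Q)` UNKNOWN).  Lead c1 settled its missing-bond species on
sub-configurations of the fcc LATTICE (`latticeSubsetGap`); this file does the same for the
conjectured Lennard-Jones ground state itself, the hexagonal close packing, which is NOT a lattice:
for every finite set of distinct particles `x` drawn from the ideal stacking `hcpStacking a h`
(nearest-neighbour distance `a ∈ [47/50, 1]`, `h² = ⅔a²`) — vacancies, vacancy clusters, voids,
free surfaces and finite crystal pieces of ANY shape —

  `N · e* + (15/1536) · #{i : particle i is not 1/20-good} ≤ 𝓔_LJ(x)`   (`hcpSubsetGap`),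

i.e. the route's TARGET `CoerciveTwoShellGap` (a fortiori `TightContactGap`, `ContactGap`,
`FarFieldGapR`, `AllBadGap`) on this class, `g = 15/1536 ≈ 0.0098`.  Mechanism: `e* ≤ e(hcp_{a,h})`
(`eStar_le` — the only use of `e*`); VERTEX-TRANSITIVITY in place of translation invariance: by
`hcpStacking_homogeneous` every particle sees the stacking as the origin does, up to a linear
isometry, so `½ Σ_{j ≠ i} V(|x_i − x_j|) = e(hcp_{a,h}) − ½ Σ_{w ∈ hcp ∖ x} V(|w − x_i|)` at every
particle (`energyPerParticle_hcp_eq_half_tsum`; absolutely convergent sums); every vacant term is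
`≤ 0` (the ideal stacking is `a`-separated, `V_LJ ≤ 0` from `47/50` on); a bad particle owns a
vacant two-shell site at distance `a` or `√2·a` worth `≤ −15/768` (part 1,
`exists_vacant_site_of_bad_hcp`).  Registered sub-goal `stub_hcpSubsetGap` of the crux item.
-/

noncomputable section

namespace Summit.AtomisticToContinuum.Crystallization.Theorems.PhononSlackCertificatesNearFarGlueR

open Literature.MathematicalPhysics.StatisticalMechanics
open Literature.Geometry.DiscreteGeometry
open Summit.AtomisticToContinuum.Crystallization.Theses.PhononSlackCertificates
open Summit.AtomisticToContinuum.Crystallization.Theorems.ChargedEnergyGapNegative (eStar_le)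
open Summit.AtomisticToContinuum.Crystallization.Theorems.NearFarGlueRNegative (sum_halfSite_sub_eStar)
open Summit.AtomisticToContinuum.Crystallization.Theorems.DominationEnergyLimit
  (energyPerParticle_hcp_eq_half_tsum tsum_ne_zero_eq_tsum)
open scoped BigOperators

/-! ## §5 The site-sum identity on the hcp stacking and the gap -/

/-- **The target on hcp sub-configurations** (registered sub-goal `stub_hcpSubsetGap` of the
crux item, theorem form).  For distinct particles on the ideal stacking `hcpStacking a h`,
`a ∈ [47/50, 1]`, `h² = ⅔a²`: `N · e* + (15/1536) · #bad ≤ 𝓔_LJ(x)`.  Proof: `e* ≤ e(hcp_{a,h})`;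
for every particle `½ Σ_{j≠i} V = e(hcp_{a,h}) − ½ Σ_{vacant w} V(|w − x_i|)` (carry the site sum
of the origin to `x_i` by the linear isometry of `hcpStacking_homogeneous`, split it over occupied
and vacant sites); all vacant terms are `≤ 0`, and a bad particle owns a vacant two-shell site
worth `≤ −15/768` (`exists_vacant_site_of_bad_hcp`, `lennardJones_le_of_window`,
`lennardJones_sqrt_two_mul_le`). [folklore] -/
theorem hcpSubsetGap {a h : ℝ} (h47 : 47 / 50 ≤ a) (h1 : a ≤ 1) (h0 : 0 < h)
    (hh : h ^ 2 = 2 / 3 * a ^ 2) {N : ℕ} (x : Fin N → (EuclideanSpace ℝ (Fin 3)))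
    (hx : Function.Injective x) (hL : ∀ j, x j ∈ hcpStacking a h) :
    (N : ℝ) * (⨅ Q : PeriodicConfiguration 3, Q.energyPerParticle lennardJones) +
      (15 / 1536) * (Nat.card {i : Fin N // ¬ IsTwoShellGood (1 / 20) (47 / 50) 1 x i} : ℝ) ≤
      interactionEnergy lennardJones x := by
  classical
  have ha : 0 < a := by linarith
  have ha0 : a ≠ 0 := ha.ne'
  have hh0 : h ≠ 0 := h0.ne'
  set L : Set (EuclideanSpace ℝ (Fin 3)) := hcpStacking a h with hLdef
  set P : PeriodicConfiguration 3 := hcpPeriodicConfiguration ha0 hh0 with hPdef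
  have hpts : P.points = L := hcpPeriodicConfiguration_points ha0 hh0
  set ea : ℝ := P.energyPerParticle lennardJones with hea_def
  have hea : (⨅ Q : PeriodicConfiguration 3, Q.energyPerParticle lennardJones) ≤ ea := eStar_le P
  -- the site sum at the origin
  have h2ea : (∑' y : {y : (EuclideanSpace ℝ (Fin 3)) // y ∈ L ∧ y ≠ 0},
      lennardJones ‖(y : (EuclideanSpace ℝ (Fin 3)))‖) = 2 * ea := by
    rw [hea_def, energyPerParticle_hcp_eq_half_tsum ha0 hh0 lennardJones lennardJones_zero,
      tsum_ne_zero_eq_tsum (fun p => lennardJones ‖p‖) (by simp [lennardJones_zero])]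
    ring
  have hsum0 : Summable fun y : {y : (EuclideanSpace ℝ (Fin 3)) // y ∈ L ∧ y ≠ 0} =>
      lennardJones ‖(y : (EuclideanSpace ℝ (Fin 3)))‖ := by
    have h := P.summable_lennardJones_dist_three 0
    rw [hpts] at h
    refine h.congr fun y => ?_
    rw [dist_comm, dist_zero_right]
  -- occupied sites
  set S : Finset (EuclideanSpace ℝ (Fin 3)) := Finset.univ.image x with hS
  have hmemS : ∀ w : (EuclideanSpace ℝ (Fin 3)), w ∈ S ↔ w ∈ Set.range x := fun w => by
    rw [hS]; simp [eq_comm]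
  -- the transported, zero-extended site sum around particle `i`
  set s : Fin N → Set (EuclideanSpace ℝ (Fin 3)) := fun i => {w | w ∈ L ∧ w ≠ x i} with hs
  set F : Fin N → (EuclideanSpace ℝ (Fin 3)) → ℝ := fun i w => lennardJones ‖w - x i‖ with hF
  set G : Fin N → (EuclideanSpace ℝ (Fin 3)) → ℝ := fun i => (s i).indicator (F i) with hG
  -- (A) `∑' G i = 2 ea` and `G i` is summable (vertex-transitivity)
  have hT : ∀ i : Fin N, (∑' w, G i w) = 2 * ea ∧ Summable (G i) := by
    intro i
    have hxi : x i ∈ L := hL i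
    obtain ⟨B, hB⟩ := hcpStacking_homogeneous a h hxi
    let T : (s i) ≃ {y : (EuclideanSpace ℝ (Fin 3)) // y ∈ L ∧ y ≠ 0} :=
      { toFun := fun w => ⟨B.symm ((w : (EuclideanSpace ℝ (Fin 3))) - x i), by
          constructor
          · rw [hB, LinearIsometryEquiv.apply_symm_apply, add_sub_cancel]
            exact w.2.1
          · intro h0'
            have : (w : EuclideanSpace ℝ (Fin 3)) - x i = 0 := by
              have := congrArg B h0'
              rwa [LinearIsometryEquiv.apply_symm_apply, LinearIsometryEquiv.map_zero] at this
            exact w.2.2 (sub_eq_zero.1 this)⟩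
        invFun := fun y => ⟨x i + B (y : (EuclideanSpace ℝ (Fin 3))), (hB _).1 y.2.1, fun h0' =>
          y.2.2 (by
            have : B (y : EuclideanSpace ℝ (Fin 3)) = 0 := by
              have h' : x i + B (y : EuclideanSpace ℝ (Fin 3)) = x i + 0 := by rw [add_zero]; exact h0'
              exact add_left_cancel h'
            exact (LinearIsometryEquiv.map_eq_zero_iff B).1 this)⟩
        left_inv := fun w => by ext; simp
        right_inv := fun y => by ext; simp }
    have hTF : ∀ w : s i, F i w = lennardJones ‖((T w : {y : (EuclideanSpace ℝ (Fin 3)) // y ∈ L ∧ y ≠ 0}) :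
        EuclideanSpace ℝ (Fin 3))‖ := by
      intro w
      change lennardJones ‖(w : EuclideanSpace ℝ (Fin 3)) - x i‖ =
        lennardJones ‖B.symm ((w : EuclideanSpace ℝ (Fin 3)) - x i)‖
      rw [LinearIsometryEquiv.norm_map]
    have htsum : (∑' w : s i, F i w) = ∑' y : {y : (EuclideanSpace ℝ (Fin 3)) // y ∈ L ∧ y ≠ 0},
        lennardJones ‖(y : (EuclideanSpace ℝ (Fin 3)))‖ := by
      rw [← Equiv.tsum_eq T (fun y => lennardJones ‖(y : (EuclideanSpace ℝ (Fin 3)))‖)]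
      exact tsum_congr fun w => hTF w
    have hsumT : Summable (F i ∘ (↑) : s i → ℝ) := by
      have h' : (F i ∘ (↑) : s i → ℝ) =
          (fun y : {y : (EuclideanSpace ℝ (Fin 3)) // y ∈ L ∧ y ≠ 0} =>
            lennardJones ‖(y : (EuclideanSpace ℝ (Fin 3)))‖) ∘ T := by
        funext w; exact hTF w
      rw [h']
      exact (T.summable_iff).2 hsum0
    refine ⟨?_, summable_subtype_iff_indicator.1 hsumT⟩
    rw [hG]
    change (∑' w, (s i).indicator (F i) w) = 2 * ea
    rw [← tsum_subtype (s i) (F i), htsum, h2ea]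
  -- (B) the occupied part of `G i` is the finite site sum
  have hocc : ∀ i : Fin N, ∑ w ∈ S, G i w = ∑ j ∈ Finset.univ.erase i, lennardJones (dist (x i) (x j)) := by
    intro i
    rw [hS, Finset.sum_image (fun j _ k _ hjk => hx hjk)]
    rw [← Finset.add_sum_erase Finset.univ (fun j => G i (x j)) (Finset.mem_univ i)]
    have hii : G i (x i) = 0 := by
      rw [hG]
      exact Set.indicator_of_notMem (fun h => h.2 rfl) _
    rw [hii, zero_add]
    refine Finset.sum_congr rfl fun j hj => ?_
    have hji : j ≠ i := Finset.ne_of_mem_erase hj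
    have hmem : x j ∈ s i := ⟨hL j, fun h => hji (hx h)⟩
    rw [hG]
    change (s i).indicator (F i) (x j) = _
    rw [Set.indicator_of_mem hmem, hF]
    change lennardJones ‖x j - x i‖ = lennardJones (dist (x i) (x j))
    rw [← dist_eq_norm, dist_comm]
  -- (C) the vacant part is non-positive, and ≤ −15/768 at a bad particle
  have hGle : ∀ i : Fin N, ∀ w : (EuclideanSpace ℝ (Fin 3)), G i w ≤ 0 := by
    intro i w
    rw [hG]
    change (s i).indicator (F i) w ≤ 0
    by_cases hw : w ∈ s i
    · rw [Set.indicator_of_mem hw, hF]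
      change lennardJones ‖w - x i‖ ≤ 0
      have hd : a ≤ dist w (x i) :=
        le_dist_of_mem_barlowStacking_ideal isHaggSeq_alternating ha hh hw.1 (hL i) hw.2
      rw [dist_eq_norm] at hd
      exact lennardJones_nonpos_of_ge (h47.trans hd)
    · rw [Set.indicator_of_notMem hw]
  have hR0 : ∀ i : Fin N, (∑' w : ↑((↑S : Set (EuclideanSpace ℝ (Fin 3)))ᶜ), G i w) ≤ 0 := fun i =>
    tsum_nonpos fun w => hGle i w
  have hRbad : ∀ i : Fin N, ¬ IsTwoShellGood (1 / 20) (47 / 50) 1 x i →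
      (∑' w : ↑((↑S : Set (EuclideanSpace ℝ (Fin 3)))ᶜ), G i w) ≤ -(15 / 768) := by
    intro i hbad
    obtain ⟨w₀, hw₀L, hvac, hdist⟩ := exists_vacant_site_of_bad_hcp h47 h1 h0 hh hx hL i hbad
    have hw₀S : w₀ ∈ ((↑S : Set (EuclideanSpace ℝ (Fin 3)))ᶜ) := by
      rw [Set.mem_compl_iff, Finset.mem_coe, hmemS]
      exact hvac
    have hw₀ne : w₀ ≠ x i := fun h => hvac ⟨i, h.symm⟩
    have hw₀s : w₀ ∈ s i := ⟨hw₀L, hw₀ne⟩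
    have hGw₀ : G i w₀ ≤ -(15 / 768) := by
      rw [hG]
      change (s i).indicator (F i) w₀ ≤ _
      rw [Set.indicator_of_mem hw₀s, hF]
      change lennardJones ‖w₀ - x i‖ ≤ _
      rw [← dist_eq_norm]
      rcases hdist with hd | hd
      · rw [hd]; exact lennardJones_le_of_window h47 h1
      · rw [hd, ← lennardJones_sqrt_two]; exact lennardJones_sqrt_two_mul_le h47 h1
    have hg : Summable fun w : ↑((↑S : Set (EuclideanSpace ℝ (Fin 3)))ᶜ) => G i w := (hT i).2.subtype _
    have hle := hg.neg.le_tsum ⟨w₀, hw₀S⟩ (fun w _ => neg_nonneg.2 (hGle i w))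
    rw [tsum_neg] at hle
    change -G i w₀ ≤ -(∑' w : ↑((↑S : Set (EuclideanSpace ℝ (Fin 3)))ᶜ), G i w) at hle
    have hle' : (∑' w : ↑((↑S : Set (EuclideanSpace ℝ (Fin 3)))ᶜ), G i w) ≤ G i w₀ := by linarith
    exact hle'.trans hGw₀
  -- (D) the per-particle inequality
  have hsite : ∀ i : Fin N,
      ea - (1 / 2) * (∑' w : ↑((↑S : Set (EuclideanSpace ℝ (Fin 3)))ᶜ), G i w) =
        (1 / 2 : ℝ) * ∑ j ∈ Finset.univ.erase i, lennardJones (dist (x i) (x j)) := by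
    intro i
    have hsplit := (hT i).2.sum_add_tsum_compl (s := S)
    rw [(hT i).1, hocc i] at hsplit
    linarith
  have hpt : ∀ i : Fin N,
      (if ¬ IsTwoShellGood (1 / 20) (47 / 50) 1 x i then (15 / 1536 : ℝ) else 0) ≤
        (1 / 2 : ℝ) * (∑ j ∈ Finset.univ.erase i, lennardJones (dist (x i) (x j))) -
          (⨅ Q : PeriodicConfiguration 3, Q.energyPerParticle lennardJones) := by
    intro i
    rw [← hsite i]
    by_cases hbad : IsTwoShellGood (1 / 20) (47 / 50) 1 x i
    · rw [if_neg (not_not_intro hbad)]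
      have := hR0 i
      linarith
    · rw [if_pos hbad]
      have := hRbad i hbad
      linarith
  -- (E) sum over the particles
  have hsum := Finset.sum_le_sum fun i (_ : i ∈ Finset.univ) => hpt i
  rw [sum_halfSite_sub_eStar x] at hsum
  have hcount : ∑ i, (if ¬ IsTwoShellGood (1 / 20) (47 / 50) 1 x i then (15 / 1536 : ℝ) else 0) =
      (15 / 1536) * (Nat.card {i : Fin N // ¬ IsTwoShellGood (1 / 20) (47 / 50) 1 x i} : ℝ) := by
    rw [Finset.sum_ite, Finset.sum_const_zero, add_zero, Finset.sum_const, nsmul_eq_mul, mul_comm]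
    congr 1
    have e : {i : Fin N // ¬ IsTwoShellGood (1 / 20) (47 / 50) 1 x i} ≃
        {i : Fin N // i ∈ Finset.univ.filter fun i => ¬ IsTwoShellGood (1 / 20) (47 / 50) 1 x i} :=
      Equiv.subtypeEquivRight fun i => by simp
    rw [Nat.card_congr e, Nat.card_eq_fintype_card, Fintype.card_coe]
  rw [hcount] at hsum
  linarith

/-- **Corollary: `AllBadGap` on hcp sub-configurations.**  If every particle of an hcp
sub-configuration is bad (thin plates, needles, porous pieces: every particle misses a two-shell
site), then `N · (e* + 15/1536) ≤ 𝓔_LJ(x)`. [folklore] -/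
theorem allBad_hcpSubsetGap {a h : ℝ} (h47 : 47 / 50 ≤ a) (h1 : a ≤ 1) (h0 : 0 < h)
    (hh : h ^ 2 = 2 / 3 * a ^ 2) {N : ℕ}
    (x : Fin N → (EuclideanSpace ℝ (Fin 3))) (hx : Function.Injective x)
    (hL : ∀ j, x j ∈ hcpStacking a h)
    (hbad : ∀ i : Fin N, ¬ IsTwoShellGood (1 / 20) (47 / 50) 1 x i) :
    (N : ℝ) * ((⨅ Q : PeriodicConfiguration 3, Q.energyPerParticle lennardJones) + 15 / 1536) ≤
      interactionEnergy lennardJones x := by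
  have hg := hcpSubsetGap h47 h1 h0 hh x hx hL
  have hcard : (Nat.card {i : Fin N // ¬ IsTwoShellGood (1 / 20) (47 / 50) 1 x i} : ℝ) = N := by
    have e : {i : Fin N // ¬ IsTwoShellGood (1 / 20) (47 / 50) 1 x i} ≃ Fin N :=
      Equiv.subtypeUnivEquiv hbad
    rw [Nat.card_congr e, Nat.card_eq_fintype_card, Fintype.card_fin]
  rw [hcard] at hg
  linarith

/-- **Isometric form.**  The same bound for every configuration CONGRUENT to an hcp
sub-configuration: if some isometry `g` of `ℝ³` carries all particles into the ideal stacking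
`hcpStacking a h`, then `N · e* + (15/1536) · #bad ≤ 𝓔_LJ(x)` (energy by
`interactionEnergy_comp_isometry`, badness by `IsTwoShellGood.map_isometryEquiv` applied to
`g.symm`). [folklore] -/
theorem hcpSubsetGap_of_isometry {a h : ℝ} (h47 : 47 / 50 ≤ a) (h1 : a ≤ 1) (h0 : 0 < h)
    (hh : h ^ 2 = 2 / 3 * a ^ 2) {N : ℕ}
    (x : Fin N → (EuclideanSpace ℝ (Fin 3))) (hx : Function.Injective x)
    (g : (EuclideanSpace ℝ (Fin 3)) ≃ᵢ (EuclideanSpace ℝ (Fin 3)))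
    (hL : ∀ j, g (x j) ∈ hcpStacking a h) :
    (N : ℝ) * (⨅ Q : PeriodicConfiguration 3, Q.energyPerParticle lennardJones) +
      (15 / 1536) * (Nat.card {i : Fin N // ¬ IsTwoShellGood (1 / 20) (47 / 50) 1 x i} : ℝ) ≤
      interactionEnergy lennardJones x := by
  set y : Fin N → (EuclideanSpace ℝ (Fin 3)) := fun j => g (x j) with hy
  have hyinj : Function.Injective y := fun j k hjk => hx (g.injective hjk)
  have hE : interactionEnergy lennardJones y = interactionEnergy lennardJones x :=
    interactionEnergy_comp_isometry lennardJones g.isometry x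
  have hg := hcpSubsetGap h47 h1 h0 hh y hyinj hL
  rw [hE] at hg
  have hmono : (Nat.card {i : Fin N // ¬ IsTwoShellGood (1 / 20) (47 / 50) 1 x i} : ℝ) ≤
      (Nat.card {i : Fin N // ¬ IsTwoShellGood (1 / 20) (47 / 50) 1 y i} : ℝ) := by
    have hxy : ∀ i, IsTwoShellGood (1 / 20) (47 / 50) 1 y i → IsTwoShellGood (1 / 20) (47 / 50) 1 x i := by
      intro i hi
      have := hi.map_isometryEquiv g.symm
      simpa [hy] using this
    exact_mod_cast Nat.card_le_card_of_injective
      (fun b : {i : Fin N // ¬ IsTwoShellGood (1 / 20) (47 / 50) 1 x i} =>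
        (⟨b.1, fun hgood => b.2 (hxy b.1 hgood)⟩ : {i : Fin N // ¬ IsTwoShellGood (1 / 20) (47 / 50) 1 y i}))
      (fun b c hbc => Subtype.ext (by simpa using congrArg Subtype.val hbc))
  nlinarith [hmono, hg]

/-- **Registered sub-goal `stub_hcpSubsetGap` of the crux item** (line `Sketch`, continuation
lead c2): the route's target `CoerciveTwoShellGap` — hence the line's residual `TightContactGap` —
HOLDS, with the explicit constant `15/1536` and at every separation, on the sub-configurations of
the ideal hexagonal close packing `hcpStacking a h`, `a ∈ [47/50, 1]`, `h² = ⅔a²` (vacancies,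
voids, free surfaces, finite pieces of any shape of the conjectured Lennard-Jones ground state),
without any knowledge of `e*`. [folklore] -/
theorem stub_hcpSubsetGap :
    ∀ a h : ℝ, 47 / 50 ≤ a → a ≤ 1 → 0 < h → h ^ 2 = 2 / 3 * a ^ 2 →
    ∀ (N : ℕ) (x : Fin N → EuclideanSpace ℝ (Fin 3)), Function.Injective x →
      (∀ j : Fin N, x j ∈ hcpStacking a h) →
      (N : ℝ) * (⨅ Q : PeriodicConfiguration 3, Q.energyPerParticle lennardJones) +
        (15 / 1536) * (Nat.card {i : Fin N // ¬ IsTwoShellGood (1 / 20) (47 / 50) 1 x i} : ℝ) ≤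
        interactionEnergy lennardJones x :=
  fun _ _ h47 h1 h0 hh _ x hx hL => hcpSubsetGap h47 h1 h0 hh x hx hL

end Summit.AtomisticToContinuum.Crystallization.Theorems.PhononSlackCertificatesNearFarGlueR

end
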